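import Mathlib
import Literature.AlgebraicGeometry.Resolution.CompositeValuations
import Literature.AlgebraicGeometry.Resolution.LocalBlowup
import HarnessLib

/-!
# Route `RadicialJung`, crux `CleanModels` (stmt-15917), stub `stub_cleanLU3DefectNonDiscrete`, sub-line (C-div): the RESIDUE MAP on
# subrings — images of models in the residue field of the coarse valuation ring

Line `Sketch` rev 24 of crux stmt-ResolutionOfSingularities-15917; lead `res-B-lead-1` g4 (workfile `Lines/Sketch_Cdiv_assembly.lean` v2,
piece RESIDUE FRAME, generic half).  OURS; nothing here proves resolution in characteristic `p`.

For valuation rings `O ≤ O₁` of a field `K`, with residue field `κ₁ = O₁/𝔪₁` and residue valuation ring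
`Ō = residueValuationSubring O O₁` (`Literature/…/CompositeValuations.lean`), and a subring `B ⊆ O`, we write
`im B := (B.comap O₁.subtype).map (residue O₁) ⊆ κ₁` for the image of `B` under the residue map.  This file proves the bookkeeping the
(C-div) slice needs: membership (`mem_residueImage_iff`), `im B ⊆ Ō` (`residueImage_le`), units and non-units of `O` go to units and
non-units of `Ō` (`residue_valuation_eq_one_iff`, `residue_valuation_lt_one_iff`), the residue of a quotient (`residue_div_eq`), and the
key identity `im (locAtCentre B O) = locAtCentre (im B) Ō` (`residueImage_locAtCentre`): localising at the centre commutes with passing to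
the residue field of the coarsening; images of generated subrings (`residueImage_closure`), monotonicity, and the comparison of values
through residues (`valuation_le_of_residue_le`).
-/

noncomputable section

set_option linter.dupNamespace false -- mandated namespace of this single-conjunct summit

open IsLocalRing
open Literature.AlgebraicGeometry.Resolution

namespace Summit.ResolutionOfSingularities.ResolutionOfSingularities.Theorems.RadicialJung.CleanModels

variable {K : Type} [Field K]

/-- Membership in the residue image `im B` of a subring `B ⊆ O₁`: `s ∈ im B` iff `s = residue x` for some `x ∈ B`. [folklore] -/
theorem mem_residueImage_iff (O₁ : ValuationSubring K) (B : Subring K) (hB : B ≤ O₁.toSubring) (s : ResidueField O₁) :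
    s ∈ (B.comap O₁.toSubring.subtype).map (residue O₁) ↔ ∃ (x : K) (hx : x ∈ B), residue O₁ ⟨x, hB hx⟩ = s := by
  constructor
  · rintro ⟨y, hy, rfl⟩
    exact ⟨(y : K), hy, rfl⟩
  · rintro ⟨x, hx, rfl⟩
    exact ⟨⟨x, hB hx⟩, hx, rfl⟩

/-- The residue of an element of `B ⊆ O₁` lies in `im B`. [folklore] -/
theorem residue_mem_residueImage (O₁ : ValuationSubring K) (B : Subring K) (hB : B ≤ O₁.toSubring) {x : K} (hx : x ∈ B) :
    residue O₁ ⟨x, hB hx⟩ ∈ (B.comap O₁.toSubring.subtype).map (residue O₁) :=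
  (mem_residueImage_iff O₁ B hB _).mpr ⟨x, hx, rfl⟩

/-- `im B ⊆ Ō` for `B ⊆ O ≤ O₁`. [folklore] -/
theorem residueImage_le (O O₁ : ValuationSubring K) (h : O ≤ O₁) (B : Subring K) (hBO : B ≤ O.toSubring) :
    (B.comap O₁.toSubring.subtype).map (residue O₁) ≤ (residueValuationSubring O O₁ h).toSubring := by
  rintro _ ⟨y, hy, rfl⟩
  exact (residue_mem_residueValuationSubring_iff O O₁ h y).mpr (hBO hy)

/-- The maximal ideal of the coarsening lies in the maximal ideal of `O`: `v₁ x < 1 ⟹ v x < 1`. [folklore] -/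
theorem valuation_lt_one_of_coarse_lt_one (O O₁ : ValuationSubring K) (h : O ≤ O₁) {x : K}
    (hx : O₁.valuation x < 1) : O.valuation x < 1 := by
  by_contra hle
  rw [not_lt] at hle
  by_cases hx0 : x = 0
  · rw [hx0, map_zero] at hx hle; exact absurd hle (not_le.mpr zero_lt_one)
  -- `v x ≥ 1` ⟹ `x⁻¹ ∈ O ⊆ O₁` ⟹ `v₁ x ≥ 1`
  have hinv : x⁻¹ ∈ O := by
    rw [← O.valuation_le_one_iff, map_inv₀]; exact inv_le_one_of_one_le₀ hle
  have : O₁.valuation x⁻¹ ≤ 1 := (O₁.valuation_le_one_iff _).mpr (h hinv)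
  rw [map_inv₀, inv_le_one₀ (zero_lt_iff.mpr ((Valuation.ne_zero_iff _).mpr hx0))] at this
  exact absurd hx (not_lt.mpr this)

/-- **Units of `O` have unit residues in `Ō`**: for `x ∈ O`, `v̄ (residue x) = 1 ↔ v x = 1`. [folklore] -/
theorem residue_valuation_eq_one_iff (O O₁ : ValuationSubring K) (h : O ≤ O₁) {x : K} (hx : x ∈ O) :
    (residueValuationSubring O O₁ h).valuation (residue O₁ ⟨x, h hx⟩) = 1 ↔ O.valuation x = 1 := by
  set Ō := residueValuationSubring O O₁ h
  have hmemŌ : residue O₁ ⟨x, h hx⟩ ∈ Ō := (residue_mem_residueValuationSubring_iff O O₁ h _).mpr hx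
  constructor
  · intro hv
    -- `residue x` is a unit of `Ō`: its inverse is `residue y` with `y ∈ O`, and `x y - 1 ∈ 𝔪₁ ⊆ 𝔪_O`
    have hr0 : residue O₁ ⟨x, h hx⟩ ≠ 0 := ne_zero_of_valuation_eq_one hv
    have hinvŌ : (residue O₁ ⟨x, h hx⟩)⁻¹ ∈ Ō := by
      rw [← Ō.valuation_le_one_iff, map_inv₀, hv, inv_one]
    obtain ⟨⟨y, hy⟩, hyres⟩ := (mem_residueValuationSubring_iff O O₁ h _).mp hinvŌ
    have hprod : residue O₁ (⟨x, h hx⟩ * O.inclusion O₁ h ⟨y, hy⟩) = 1 := by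
      rw [map_mul, hyres, mul_inv_cancel₀ hr0]
    rw [← map_one (residue O₁), ← sub_eq_zero, ← map_sub, residue_eq_zero_iff] at hprod
    -- `x y - 1 ∈ 𝔪₁`, hence `v (x y - 1) < 1`, hence `v (x y) = 1`, hence `v x = 1`
    have hm : O₁.valuation (x * y - 1) < 1 := by
      have := (O₁.valuation_lt_one_iff _).mp hprod
      exact this
    have hm' : O.valuation (x * y - 1) < 1 := valuation_lt_one_of_coarse_lt_one O O₁ h hm
    have hxy : O.valuation (x * y) = 1 := by
      have := Valuation.map_add_eq_of_lt_left O.valuation (x := 1) (y := x * y - 1) (by rwa [map_one])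
      rw [map_one] at this
      rwa [add_sub_cancel] at this
    have hxle : O.valuation x ≤ 1 := (O.valuation_le_one_iff _).mpr hx
    have hyle : O.valuation y ≤ 1 := (O.valuation_le_one_iff _).mpr hy
    rw [map_mul] at hxy
    by_contra hne
    have hxlt : O.valuation x < 1 := lt_of_le_of_ne hxle hne
    have : O.valuation x * O.valuation y < 1 * 1 := mul_lt_mul_of_lt_of_le_of_nonneg_of_pos hxlt hyle zero_le zero_lt_one
    rw [mul_one, hxy] at this
    exact lt_irrefl _ this
  · intro hv
    have hx0 : x ≠ 0 := ne_zero_of_valuation_eq_one hv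
    have hinv : x⁻¹ ∈ O := by rw [← O.valuation_le_one_iff, map_inv₀, hv, inv_one]
    apply le_antisymm ((Ō.valuation_le_one_iff _).mpr hmemŌ)
    -- `residue x * residue x⁻¹ = 1` with both factors in `Ō`
    have hinvŌ : residue O₁ ⟨x⁻¹, h hinv⟩ ∈ Ō := (residue_mem_residueValuationSubring_iff O O₁ h _).mpr hinv
    have hprod : residue O₁ ⟨x, h hx⟩ * residue O₁ ⟨x⁻¹, h hinv⟩ = 1 := by
      rw [← map_mul, ← map_one (residue O₁)]
      congr 1
      exact Subtype.ext (mul_inv_cancel₀ hx0)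
    have h1 : Ō.valuation (residue O₁ ⟨x, h hx⟩) * Ō.valuation (residue O₁ ⟨x⁻¹, h hinv⟩) = 1 := by
      rw [← map_mul, hprod, map_one]
    have hle' : Ō.valuation (residue O₁ ⟨x⁻¹, h hinv⟩) ≤ 1 := (Ō.valuation_le_one_iff _).mpr hinvŌ
    calc (1 : _) = Ō.valuation (residue O₁ ⟨x, h hx⟩) * Ō.valuation (residue O₁ ⟨x⁻¹, h hinv⟩) := h1.symm
      _ ≤ Ō.valuation (residue O₁ ⟨x, h hx⟩) * 1 := by gcongr
      _ = _ := mul_one _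

/-- **Non-units of `O` have non-unit residues in `Ō`**: for `x ∈ O`, `v̄ (residue x) < 1 ↔ v x < 1`. [folklore] -/
theorem residue_valuation_lt_one_iff (O O₁ : ValuationSubring K) (h : O ≤ O₁) {x : K} (hx : x ∈ O) :
    (residueValuationSubring O O₁ h).valuation (residue O₁ ⟨x, h hx⟩) < 1 ↔ O.valuation x < 1 := by
  have hle₁ : (residueValuationSubring O O₁ h).valuation (residue O₁ ⟨x, h hx⟩) ≤ 1 :=
    ((residueValuationSubring O O₁ h).valuation_le_one_iff _).mpr ((residue_mem_residueValuationSubring_iff O O₁ h _).mpr hx)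
  have hle₂ : O.valuation x ≤ 1 := (O.valuation_le_one_iff _).mpr hx
  rw [lt_iff_le_and_ne, lt_iff_le_and_ne, and_iff_right hle₁, and_iff_right hle₂, not_iff_not]
  exact residue_valuation_eq_one_iff O O₁ h hx

/-- The residue of a quotient `y / z` with `z` an `O`-unit is the quotient of the residues. [folklore] -/
theorem residue_div_eq (O O₁ : ValuationSubring K) (h : O ≤ O₁) {y z : K} (hy : y ∈ O) (hz : z ∈ O) (hvz : O.valuation z = 1) :
    residue O₁ ⟨y / z, h (show y / z ∈ O by
      rw [← O.valuation_le_one_iff, map_div₀, hvz, div_one, O.valuation_le_one_iff]; exact hy)⟩ =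
      residue O₁ ⟨y, h hy⟩ / residue O₁ ⟨z, h hz⟩ := by
  have hz0 : z ≠ 0 := ne_zero_of_valuation_eq_one hvz
  have hrz0 : residue O₁ ⟨z, h hz⟩ ≠ 0 :=
    ne_zero_of_valuation_eq_one ((residue_valuation_eq_one_iff O O₁ h hz).mpr hvz)
  rw [eq_div_iff hrz0, ← map_mul]
  congr 1
  exact Subtype.ext (div_mul_cancel₀ y hz0)

/-- **Localising at the centre commutes with the residue map**: `im (locAtCentre B O) = locAtCentre (im B) Ō` for `B ⊆ O ≤ O₁`. [folklore] -/
theorem residueImage_locAtCentre (O O₁ : ValuationSubring K) (h : O ≤ O₁) (B : Subring K) (hBO : B ≤ O.toSubring) :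
    ((locAtCentre B O).comap O₁.toSubring.subtype).map (residue O₁) =
      locAtCentre ((B.comap O₁.toSubring.subtype).map (residue O₁)) (residueValuationSubring O O₁ h) := by
  have hBO₁ : B ≤ O₁.toSubring := fun x hx => h (hBO hx)
  have hLO₁ : locAtCentre B O ≤ O₁.toSubring := fun x hx => h (locAtCentre_le hBO hx)
  ext s
  rw [mem_residueImage_iff O₁ _ hLO₁, mem_locAtCentre_iff]
  constructor
  · rintro ⟨x, hx, rfl⟩
    obtain ⟨y, hy, z, hz, hvz, rfl⟩ := (mem_locAtCentre_iff (B := B) (O := O)).mp hx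
    refine ⟨residue O₁ ⟨y, hBO₁ hy⟩, residue_mem_residueImage O₁ B hBO₁ hy, residue O₁ ⟨z, hBO₁ hz⟩,
      residue_mem_residueImage O₁ B hBO₁ hz, (residue_valuation_eq_one_iff O O₁ h (hBO hz)).mpr hvz, ?_⟩
    exact residue_div_eq O O₁ h (hBO hy) (hBO hz) hvz
  · rintro ⟨yb, hyb, zb, hzb, hvzb, rfl⟩
    obtain ⟨y, hy, rfl⟩ := (mem_residueImage_iff O₁ B hBO₁ _).mp hyb
    obtain ⟨z, hz, rfl⟩ := (mem_residueImage_iff O₁ B hBO₁ _).mp hzb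
    have hvz : O.valuation z = 1 := (residue_valuation_eq_one_iff O O₁ h (hBO hz)).mp hvzb
    exact ⟨y / z, ⟨y, hy, z, hz, hvz, rfl⟩, residue_div_eq O O₁ h (hBO hy) (hBO hz) hvz⟩

/-- **The residue image of a generated subring is generated by the residues**: for `S ⊆ O₁`,
`im (Subring.closure S) = Subring.closure (residue '' S)`. [folklore] -/
theorem residueImage_closure (O₁ : ValuationSubring K) (S : Set K) (hS : S ⊆ O₁) :
    ((Subring.closure S).comap O₁.toSubring.subtype).map (residue O₁) =
      Subring.closure ((fun x : O₁ => residue O₁ x) '' (O₁.toSubring.subtype ⁻¹' S)) := by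
  set S₁ : Set O₁ := O₁.toSubring.subtype ⁻¹' S with hS₁
  have himg : (O₁.toSubring.subtype : O₁ → K) '' S₁ = S := by
    ext x
    constructor
    · rintro ⟨y, hy, rfl⟩; exact hy
    · intro hx; exact ⟨⟨x, hS hx⟩, hx, rfl⟩
  have hcomap : (Subring.closure S).comap O₁.toSubring.subtype = Subring.closure S₁ := by
    rw [← himg, ← RingHom.map_closure, Subring.comap_map_eq_self_of_injective Subtype.val_injective]
  rw [hcomap, RingHom.map_closure]

/-- The residue image is monotone. [folklore] -/
theorem residueImage_mono (O₁ : ValuationSubring K) {B B' : Subring K} (h : B ≤ B') :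
    (B.comap O₁.toSubring.subtype).map (residue O₁) ≤ (B'.comap O₁.toSubring.subtype).map (residue O₁) :=
  fun _ hs => by
    obtain ⟨y, hy, rfl⟩ := hs
    exact ⟨y, h hy, rfl⟩

/-- **Values compare through residues**: for `x, y ∈ O` with `y` an `O₁`-unit... precisely, for `x ∈ O` and `y ∈ O` with `v y = 1`,
`v̄ (residue x) ≤ v̄ (residue y)` always, and for two `O₁`-units `x, y ∈ O`: `v x ≤ v y ↔ v̄ (res x) ≤ v̄ (res y)`.  We record the
form the slice uses: if `x ∈ O` and `y ∈ O` with `O₁.valuation y = 1` and `v̄ (res x) ≤ v̄ (res y)`, then `v x ≤ v y`. [folklore] -/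
theorem valuation_le_of_residue_le (O O₁ : ValuationSubring K) (h : O ≤ O₁) {x y : K} (hx : x ∈ O) (hy : y ∈ O)
    (hvy : O₁.valuation y = 1)
    (hle : (residueValuationSubring O O₁ h).valuation (residue O₁ ⟨x, h hx⟩) ≤
      (residueValuationSubring O O₁ h).valuation (residue O₁ ⟨y, h hy⟩)) :
    O.valuation x ≤ O.valuation y := by
  set Ō := residueValuationSubring O O₁ h
  have hy0 : y ≠ 0 := ne_zero_of_valuation_eq_one hvy
  have hry0 : residue O₁ ⟨y, h hy⟩ ≠ 0 := by
    intro h0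
    rw [residue_eq_zero_iff] at h0
    have := (O₁.valuation_lt_one_iff _).mp h0
    exact absurd hvy (ne_of_lt this)
  -- `x / y ∈ O₁` (as `y` is an `O₁`-unit) with residue `res x / res y ∈ Ō`, hence `x / y ∈ O`
  have hyinv : y⁻¹ ∈ O₁ := by rw [← O₁.valuation_le_one_iff, map_inv₀, hvy, inv_one]
  have hxy₁ : x / y ∈ O₁ := by rw [div_eq_mul_inv]; exact mul_mem (h hx) hyinv
  have hres : residue O₁ ⟨x / y, hxy₁⟩ = residue O₁ ⟨x, h hx⟩ / residue O₁ ⟨y, h hy⟩ := by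
    rw [eq_div_iff hry0, ← map_mul]
    congr 1
    exact Subtype.ext (div_mul_cancel₀ x hy0)
  have hmemŌ : residue O₁ ⟨x / y, hxy₁⟩ ∈ Ō := by
    rw [← Ō.valuation_le_one_iff, hres, map_div₀]
    exact div_le_one_of_le₀ hle zero_le
  have hxyO : x / y ∈ O := (residue_mem_residueValuationSubring_iff O O₁ h _).mp hmemŌ
  have : O.valuation (x / y) ≤ 1 := (O.valuation_le_one_iff _).mpr hxyO
  rw [map_div₀, div_le_one₀ (zero_lt_iff.mpr ((Valuation.ne_zero_iff _).mpr hy0))] at this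
  exact this

end Summit.ResolutionOfSingularities.ResolutionOfSingularities.Theorems.RadicialJung.CleanModels

end
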